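import Mathlib
import Literature.Probability.LatticeModels.GKSInequalities
import Summits.CriticalPhenomena.Ising3DConformalLimit.Theses.PrecisionLaplacian
import Summits.CriticalPhenomena.Ising3DConformalLimit.Theorems.PrecisionLaplacianInverseMFerromagnetEntryNonposOfPcov
import Summits.CriticalPhenomena.Ising3DConformalLimit.Theorems.PrecisionLaplacianInverseMFerromagnetPencilMixture
import HarnessLib

/-!
# Crux `PrecisionLaplacian.InverseMFerromagnet` (stmt-CriticalPhenomena-4798), line `Sketch` —
# stub `stub_rowTransfer_of_amp` (core F, F2: the ROW TRANSFER from the amputated four-point sign)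

THEOREM-ONLY file (no definitions).  Fix a zero-field pair ferromagnet `⟨·⟩_G = gksExpect univ K C`
(`K ≥ 0`, `|C i| = 2`), two sites `p ≠ v`, and let `H` be the system with every bond supported on
`{p,v}` switched off (`K⁰ i = if C i = {p,v} then 0 else K i`), `κ = ∑_{C i = {p,v}} K i`,
`t = tanh κ ∈ [0,1)`.  Write `A = Σ_H = (⟨σ_aσ_b⟩_H)`, `F = (⟨σ_aσ_bσ_pσ_v⟩_H)`, `ρ = ⟨σ_pσ_v⟩_H ≥ 0`,
`c = 1 + tρ > 0`, `Σ_G = (⟨σ_aσ_b⟩_G)`, `F_G = (⟨σ_aσ_bσ_pσ_v⟩_G)`, `Γ_G = Σ_G⁻¹`.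

* Pencil (`helper_pencil_mixture`, `(σ_pσ_v)² = 1`): `Σ_G = (A + tF)/c`, `F_G = (F + tA)/c`, i.e.
  `A = cΣ_G − tF`.
* Whole-matrix transfer identity (no block inverses): `Γ_G = (A⁻¹A)Γ_G = A⁻¹(cΣ_G − tF)Γ_G
  = cA⁻¹ − t·A⁻¹FΓ_G`, so `Γ_G[p,y] = cA⁻¹[p,y] − t ∑_z A⁻¹[p,z] (FΓ_G)[z,y]`.
* Row swap `F[p,·] = A[v,·]`, `F[v,·] = A[p,·]` (`σ_p² = 1`) and `AΓ_G = c·1 − tFΓ_G` give, for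
  `y ∉ {p,v}`, `(FΓ_G)[p,y] = −t(FΓ_G)[v,y]` and `(FΓ_G)[v,y] = −t(FΓ_G)[p,y]`, hence both vanish
  (`t² ≠ 1`): the `z = p, v` terms of the transfer sum drop out.
* `Γ_G F_G = t·1 + ((1−t²)/c)·Γ_G F` (`Γ_G A = c·1 − tΓ_G F`), so the amputated sign AMP
  (`(Γ_G F_G)[x,z] ≤ δ_xz` on `W = V∖{p,v}`) reads `(Γ_G F)[x,z] ≤ 0` for `x ≠ z` in `W` and
  `(1+t)(Γ_G F)[y,y] ≤ c`; and `(FΓ_G)[z,y] = (Γ_G F)[y,z]` (both factors symmetric).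
* Sign bookkeeping: with `A⁻¹[p,w] ≤ 0` for `w ≠ p` (the row hypothesis) every term `z ∈ W∖{y}` of
  the transfer sum is `≥ 0`, so `Γ_G[p,y] ≤ A⁻¹[p,y]·(c − t(Γ_G F)[y,y]) ≤ 0` because
  `c − t(Γ_G F)[y,y] ≥ c/(1+t) > 0`.
-/

namespace Summit.CriticalPhenomena.Ising3DConformalLimit.Cruxes.InverseMFerromagnet.PartialCovarianceLadder

open Literature.Probability.LatticeModels Finset Matrix

noncomputable section

/-! ## The linear-algebra core (abstract matrices) -/

/-- **Row-transfer core.**  Let `A`, `SG` be positive definite real matrices, `F`, `FG` further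
matrices and `c > 0`, `0 ≤ t < 1` reals with `A = c•SG − t•F`, `FG = c⁻¹•(F + t•A)`, `F` symmetric,
`F[p,·] = A[v,·]`, `F[v,·] = A[p,·]`.  If `(SG⁻¹ FG)[x,z] ≤ δ_xz` for all `x, z ∉ {p,v}` and
`A⁻¹[p,w] ≤ 0` for all `w ≠ p`, then `SG⁻¹[p,y] ≤ 0` for every `y ∉ {p,v}`.  (Transfer identity
`SG⁻¹ = cA⁻¹ − tA⁻¹F SG⁻¹`, vanishing of `(F SG⁻¹)[p,y]`, `(F SG⁻¹)[v,y]`, and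
`SG⁻¹ FG = t·1 + ((1−t²)/c) SG⁻¹F`.) [folklore] -/
theorem rta_core {n : ℕ} (A F SG FG : Matrix (Fin n) (Fin n) ℝ) (c t : ℝ) (p v y : Fin n)
    (hA : A.PosDef) (hSG : SG.PosDef)
    (hAeq : A = c • SG - t • F) (hFGeq : FG = c⁻¹ • (F + t • A))
    (hFsym : ∀ a b, F a b = F b a)
    (hFp : ∀ b, F p b = A v b) (hFv : ∀ b, F v b = A p b)
    (hc : 0 < c) (ht0 : 0 ≤ t) (ht1 : t < 1)
    (hyp : y ≠ p) (hyv : y ≠ v)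
    (hAMP : ∀ x z : Fin n, x ≠ p → x ≠ v → z ≠ p → z ≠ v →
      (SG⁻¹ * FG) x z ≤ if x = z then 1 else 0)
    (hrow : ∀ w : Fin n, w ≠ p → A⁻¹ p w ≤ 0) :
    SG⁻¹ p y ≤ 0 := by
  -- invertibility and symmetry
  have hAunit : IsUnit A.det := (Matrix.isUnit_iff_isUnit_det A).mp hA.isUnit
  have hSGunit : IsUnit SG.det := (Matrix.isUnit_iff_isUnit_det SG).mp hSG.isUnit
  have hAinvA : A⁻¹ * A = 1 := Matrix.nonsing_inv_mul A hAunit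
  have hSGSGinv : SG * SG⁻¹ = 1 := Matrix.mul_nonsing_inv SG hSGunit
  have hSGinvSG : SG⁻¹ * SG = 1 := Matrix.nonsing_inv_mul SG hSGunit
  have hΓsym : ∀ a b, SG⁻¹ b a = SG⁻¹ a b := fun a b => by
    have h := hSG.inv.isHermitian.apply a b
    simpa using h
  -- (1) the whole-matrix transfer identity
  have hmain : SG⁻¹ = c • A⁻¹ - t • (A⁻¹ * (F * SG⁻¹)) := by
    calc SG⁻¹ = A⁻¹ * A * SG⁻¹ := by rw [hAinvA, Matrix.one_mul]
      _ = A⁻¹ * (c • SG - t • F) * SG⁻¹ := by rw [← hAeq]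
      _ = c • (A⁻¹ * (SG * SG⁻¹)) - t • (A⁻¹ * (F * SG⁻¹)) := by
          rw [Matrix.mul_sub, Matrix.sub_mul, Matrix.mul_smul, Matrix.mul_smul,
            Matrix.smul_mul, Matrix.smul_mul, Matrix.mul_assoc, Matrix.mul_assoc]
      _ = c • A⁻¹ - t • (A⁻¹ * (F * SG⁻¹)) := by rw [hSGSGinv, Matrix.mul_one]
  -- (2) `A Γ = c•1 − t•FΓ` and `Γ A = c•1 − t•ΓF`
  have hAΓ : A * SG⁻¹ = c • (1 : Matrix (Fin n) (Fin n) ℝ) - t • (F * SG⁻¹) := by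
    rw [hAeq, Matrix.sub_mul, Matrix.smul_mul, Matrix.smul_mul, hSGSGinv]
  have hΓA : SG⁻¹ * A = c • (1 : Matrix (Fin n) (Fin n) ℝ) - t • (SG⁻¹ * F) := by
    rw [hAeq, Matrix.mul_sub, Matrix.mul_smul, Matrix.mul_smul, hSGinvSG]
  -- (3) the `(p,y)` and `(v,y)` entries of `FΓ` vanish
  have e1 : (F * SG⁻¹) p y = -t * (F * SG⁻¹) v y := by
    have h : (F * SG⁻¹) p y = (A * SG⁻¹) v y := by
      simp only [Matrix.mul_apply]
      exact Finset.sum_congr rfl fun b _ => by rw [hFp b]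
    rw [h, hAΓ, Matrix.sub_apply, Matrix.smul_apply, Matrix.smul_apply,
      Matrix.one_apply_ne hyv.symm, smul_eq_mul, smul_eq_mul]
    ring
  have e2 : (F * SG⁻¹) v y = -t * (F * SG⁻¹) p y := by
    have h : (F * SG⁻¹) v y = (A * SG⁻¹) p y := by
      simp only [Matrix.mul_apply]
      exact Finset.sum_congr rfl fun b _ => by rw [hFv b]
    rw [h, hAΓ, Matrix.sub_apply, Matrix.smul_apply, Matrix.smul_apply,
      Matrix.one_apply_ne hyp.symm, smul_eq_mul, smul_eq_mul]
    ring
  have hXp : (F * SG⁻¹) p y = 0 := by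
    have h1 : (F * SG⁻¹) p y * (1 - t ^ 2) = 0 := by linear_combination e1 - t * e2
    have ht2 : (1 - t ^ 2) ≠ 0 := by nlinarith
    rcases mul_eq_zero.mp h1 with h | h
    · exact h
    · exact absurd h ht2
  have hXv : (F * SG⁻¹) v y = 0 := by rw [e2, hXp, mul_zero]
  -- (4) transposition `(FΓ)[z,y] = (ΓF)[y,z]`
  have htr : ∀ z, (F * SG⁻¹) z y = (SG⁻¹ * F) y z := fun z => by
    simp only [Matrix.mul_apply]
    exact Finset.sum_congr rfl fun b _ => by rw [hFsym z b, hΓsym y b, mul_comm]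
  -- (5) consequences of AMP through `ΓFG = t•1 + ((1−t²)/c)•ΓF`
  have hGF : ∀ x z, (SG⁻¹ * FG) x z
      = c⁻¹ * ((SG⁻¹ * F) x z + t * (c * (1 : Matrix (Fin n) (Fin n) ℝ) x z - t * (SG⁻¹ * F) x z)) := by
    intro x z
    rw [hFGeq, Matrix.mul_smul, Matrix.mul_add, Matrix.mul_smul, hΓA]
    simp only [Matrix.smul_apply, Matrix.add_apply, Matrix.sub_apply, smul_eq_mul]
  have hc' : c⁻¹ > 0 := inv_pos.mpr hc
  have hoff : ∀ x z, x ≠ p → x ≠ v → z ≠ p → z ≠ v → x ≠ z → (SG⁻¹ * F) x z ≤ 0 := by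
    intro x z hxp hxv hzp hzv hxz
    have h := hAMP x z hxp hxv hzp hzv
    rw [if_neg hxz, hGF x z, Matrix.one_apply_ne hxz] at h
    have h' : c⁻¹ * (1 - t ^ 2) * (SG⁻¹ * F) x z ≤ 0 := by
      have : c⁻¹ * ((SG⁻¹ * F) x z + t * (c * 0 - t * (SG⁻¹ * F) x z))
          = c⁻¹ * (1 - t ^ 2) * (SG⁻¹ * F) x z := by ring
      rwa [this] at h
    have hpos : 0 < c⁻¹ * (1 - t ^ 2) := mul_pos hc' (by nlinarith)
    by_contra hneg
    push Not at hneg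
    have := mul_pos hpos hneg
    linarith
  have hdiag : 0 ≤ c - t * (SG⁻¹ * F) y y := by
    have h := hAMP y y hyp hyv hyp hyv
    rw [if_pos rfl, hGF y y, Matrix.one_apply_eq] at h
    -- multiply by `c > 0`
    have h2 : (SG⁻¹ * F) y y + t * (c - t * (SG⁻¹ * F) y y) ≤ c := by
      have := mul_le_mul_of_nonneg_left h hc.le
      rwa [← mul_assoc, mul_inv_cancel₀ hc.ne', one_mul, mul_one] at this
    set X := (SG⁻¹ * F) y y with hX
    -- `(1−t)(c − (1+t)X) ≥ 0`, `1−t > 0`, so `c ≥ (1+t)X`; then `(1+t)(c − tX) = t(c−(1+t)X) + c ≥ 0`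
    have hE : 0 ≤ (1 - t) * (c - (1 + t) * X) := by nlinarith [h2]
    have hE' : 0 ≤ c - (1 + t) * X := by
      by_contra hneg
      push Not at hneg
      have : (1 - t) * (c - (1 + t) * X) < 0 := mul_neg_of_pos_of_neg (by linarith) hneg
      linarith
    nlinarith [hE', ht0, hc]
  -- (6) the `(p,y)` entry of the transfer identity, with the sum bounded below by its `z = y` term
  have hentry : SG⁻¹ p y = c * A⁻¹ p y - t * ∑ z, A⁻¹ p z * (F * SG⁻¹) z y := by
    have h := congrFun (congrFun hmain p) y
    rw [Matrix.sub_apply, Matrix.smul_apply, Matrix.smul_apply, smul_eq_mul, smul_eq_mul] at h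
    rw [h, Matrix.mul_apply]
  have hterm : ∀ z, z ≠ y → 0 ≤ A⁻¹ p z * (F * SG⁻¹) z y := by
    intro z hzy
    by_cases hzp : z = p
    · rw [hzp, hXp, mul_zero]
    by_cases hzv : z = v
    · rw [hzv, hXv, mul_zero]
    have h1 : A⁻¹ p z ≤ 0 := hrow z hzp
    have h2 : (F * SG⁻¹) z y ≤ 0 := by
      rw [htr z]
      exact hoff y z hyp hyv hzp hzv (Ne.symm hzy)
    nlinarith
  have hsum : A⁻¹ p y * (F * SG⁻¹) y y ≤ ∑ z, A⁻¹ p z * (F * SG⁻¹) z y := by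
    rw [← Finset.add_sum_erase Finset.univ _ (Finset.mem_univ y)]
    have : 0 ≤ ∑ z ∈ Finset.univ.erase y, A⁻¹ p z * (F * SG⁻¹) z y :=
      Finset.sum_nonneg fun z hz => hterm z (Finset.ne_of_mem_erase hz)
    linarith
  have hy0 : A⁻¹ p y ≤ 0 := hrow y hyp
  have hfin : SG⁻¹ p y ≤ A⁻¹ p y * (c - t * (SG⁻¹ * F) y y) := by
    rw [hentry, ← htr y]
    nlinarith [hsum, ht0]
  calc SG⁻¹ p y ≤ A⁻¹ p y * (c - t * (SG⁻¹ * F) y y) := hfin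
    _ ≤ 0 := by nlinarith [hy0, hdiag]

/-! ## The registered stub -/

/-- **F2 · `stub_rowTransfer_of_amp` — the identity (pure linear algebra + the pencil relation).**  From F1: if the
row `p` of the precision of the system with the support `{p,v}` zeroed is nonpositive off the diagonal, then so is
the row `p` of the precision of the full system, away from `v`.  Proof: `rta_core` applied to
`A = Σ_H`, `F = (⟨σ_aσ_bσ_pσ_v⟩_H)`, `Σ_G`, `F_G`, `c = 1 + tanh κ ⟨σ_pσ_v⟩_H`, `t = tanh κ`, the two
matrix relations being the pencil identity `helper_pencil_mixture`; positivity from GKS I and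
`schur_posDef`. [folklore] -/
theorem stub_rowTransfer_of_amp :
    (∀ (n m : ℕ) (K : Fin m → ℝ) (C : Fin m → Finset (Fin n)), (∀ i, 0 ≤ K i) → (∀ i, (C i).card = 2) →
      ∀ (p v x y : Fin n), p ≠ v → x ≠ p → x ≠ v → y ≠ p → y ≠ v →
        ((Matrix.of fun a b : Fin n => gksExpect Finset.univ K C (fun ω => spinAt a ω * spinAt b ω))⁻¹ *
            (Matrix.of fun a b : Fin n =>
              gksExpect Finset.univ K C (fun ω => spinAt a ω * spinAt b ω * (spinAt p ω * spinAt v ω)))) x y ≤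
          if x = y then 1 else 0) →
    ∀ (n m : ℕ) (K : Fin m → ℝ) (C : Fin m → Finset (Fin n)), (∀ i, 0 ≤ K i) → (∀ i, (C i).card = 2) →
      ∀ (p v : Fin n), p ≠ v →
        (∀ w : Fin n, w ≠ p →
          (Matrix.of fun a b : Fin n =>
              gksExpect Finset.univ (fun i => if C i = {p, v} then 0 else K i) C
                (fun ω => spinAt a ω * spinAt b ω))⁻¹ p w ≤ 0) →
        ∀ y : Fin n, y ≠ p → y ≠ v →
          (Matrix.of fun a b : Fin n => gksExpect Finset.univ K C (fun ω => spinAt a ω * spinAt b ω))⁻¹ p y ≤ 0 := by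
  intro hAMP n m K C hK hC p v hpv hrow y hyp hyv
  -- the deleted couplings, the pair coupling, `t = tanh κ`, `ρ = ⟨σ_pσ_v⟩_H`, `c = 1 + tρ`
  set K0 : Fin m → ℝ := fun i => if C i = ({p, v} : Finset (Fin n)) then 0 else K i with hK0
  set κ : ℝ := ∑ i ∈ Finset.univ.filter (fun i => C i = ({p, v} : Finset (Fin n))), K i with hκ
  set t : ℝ := Real.tanh κ with ht
  set ρ : ℝ := gksExpect Finset.univ K0 C (fun ω => spinAt p ω * spinAt v ω) with hρ
  set c : ℝ := 1 + t * ρ with hcdef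
  -- the four matrices
  set A : Matrix (Fin n) (Fin n) ℝ :=
    Matrix.of fun a b : Fin n => gksExpect Finset.univ K0 C (fun ω => spinAt a ω * spinAt b ω) with hAdef
  set F : Matrix (Fin n) (Fin n) ℝ := Matrix.of fun a b : Fin n =>
    gksExpect Finset.univ K0 C (fun ω => spinAt a ω * spinAt b ω * (spinAt p ω * spinAt v ω)) with hFdef
  set SG : Matrix (Fin n) (Fin n) ℝ :=
    Matrix.of fun a b : Fin n => gksExpect Finset.univ K C (fun ω => spinAt a ω * spinAt b ω) with hSGdef
  set FG : Matrix (Fin n) (Fin n) ℝ := Matrix.of fun a b : Fin n =>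
    gksExpect Finset.univ K C (fun ω => spinAt a ω * spinAt b ω * (spinAt p ω * spinAt v ω)) with hFGdef
  -- scalars: `K0 ≥ 0`, `ρ ≥ 0`, `0 ≤ t < 1`, `c > 0`
  have hK0nn : ∀ i ∈ (Finset.univ : Finset (Fin m)), 0 ≤ K0 i := by
    intro i _
    simp only [hK0]
    split_ifs
    · exact le_refl _
    · exact hK i
  have hρnn : 0 ≤ ρ := by
    have h := gksExpect_spinProduct_nonneg Finset.univ K0 C hK0nn ({p, v} : Finset (Fin n))
    have hfun : spinProduct ({p, v} : Finset (Fin n)) = fun ω => spinAt p ω * spinAt v ω := by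
      funext ω
      simp only [spinProduct]
      rw [Finset.prod_pair hpv]
    rwa [hfun] at h
  have hκnn : 0 ≤ κ := Finset.sum_nonneg fun i _ => hK i
  have ht0 : 0 ≤ t := by
    rw [ht, Real.tanh_eq_sinh_div_cosh]
    exact div_nonneg (Real.sinh_nonneg_iff.2 hκnn) (Real.cosh_pos _).le
  have ht1 : t < 1 := Real.tanh_lt_one _
  have hc : 0 < c := by
    have : 0 ≤ t * ρ := mul_nonneg ht0 hρnn
    linarith
  -- the pencil relations, entrywise
  have P1 : ∀ a b : Fin n, SG a b = (A a b + t * F a b) / c := by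
    intro a b
    exact helper_pencil_mixture n m K C p v hpv (fun ω => spinAt a ω * spinAt b ω)
  have P2 : ∀ a b : Fin n, FG a b = (F a b + t * A a b) / c := by
    intro a b
    have h := helper_pencil_mixture n m K C p v hpv
      (fun ω => spinAt a ω * spinAt b ω * (spinAt p ω * spinAt v ω))
    have hsq : ∀ ω : SpinConfig (Fin n),
        spinAt a ω * spinAt b ω * (spinAt p ω * spinAt v ω) * (spinAt p ω * spinAt v ω)
          = spinAt a ω * spinAt b ω := by
      intro ω
      have h1 : spinAt p ω * spinAt p ω = 1 := spinAt_mul_self p ω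
      have h2 : spinAt v ω * spinAt v ω = 1 := spinAt_mul_self v ω
      calc spinAt a ω * spinAt b ω * (spinAt p ω * spinAt v ω) * (spinAt p ω * spinAt v ω)
          = spinAt a ω * spinAt b ω * ((spinAt p ω * spinAt p ω) * (spinAt v ω * spinAt v ω)) := by ring
        _ = spinAt a ω * spinAt b ω := by rw [h1, h2, mul_one, mul_one]
    simp only [hsq] at h
    exact h
  -- matrix forms
  have hAeq : A = c • SG - t • F := by
    ext a b
    rw [Matrix.sub_apply, Matrix.smul_apply, Matrix.smul_apply, smul_eq_mul, smul_eq_mul, P1 a b]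
    field_simp
    ring
  have hFGeq : FG = c⁻¹ • (F + t • A) := by
    ext a b
    rw [Matrix.smul_apply, Matrix.add_apply, Matrix.smul_apply, smul_eq_mul, smul_eq_mul, P2 a b,
      div_eq_inv_mul]
  -- symmetry of `F` and the row swap
  have hFsym : ∀ a b, F a b = F b a := by
    intro a b
    simp only [hFdef, Matrix.of_apply]
    exact congrArg _ (funext fun ω => by ring)
  have hFp : ∀ b, F p b = A v b := by
    intro b
    simp only [hFdef, hAdef, Matrix.of_apply]
    refine congrArg _ (funext fun ω => ?_)
    have h1 : spinAt p ω * spinAt p ω = 1 := spinAt_mul_self p ω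
    calc spinAt p ω * spinAt b ω * (spinAt p ω * spinAt v ω)
        = (spinAt p ω * spinAt p ω) * (spinAt v ω * spinAt b ω) := by ring
      _ = spinAt v ω * spinAt b ω := by rw [h1, one_mul]
  have hFv : ∀ b, F v b = A p b := by
    intro b
    simp only [hFdef, hAdef, Matrix.of_apply]
    refine congrArg _ (funext fun ω => ?_)
    have h2 : spinAt v ω * spinAt v ω = 1 := spinAt_mul_self v ω
    calc spinAt v ω * spinAt b ω * (spinAt p ω * spinAt v ω)
        = (spinAt v ω * spinAt v ω) * (spinAt p ω * spinAt b ω) := by ring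
      _ = spinAt p ω * spinAt b ω := by rw [h2, one_mul]
  -- positive definiteness
  have hApd : A.PosDef := schur_posDef n m K0 C
  have hSGpd : SG.PosDef := schur_posDef n m K C
  -- the core
  exact rta_core A F SG FG c t p v y hApd hSGpd hAeq hFGeq hFsym hFp hFv hc ht0 ht1 hyp hyv
    (fun x z hxp hxv hzp hzv => hAMP n m K C hK hC p v x z hpv hxp hxv hzp hzv) hrow

end

end Summit.CriticalPhenomena.Ising3DConformalLimit.Cruxes.InverseMFerromagnet.PartialCovarianceLadder
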